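import Mathlib
import HarnessLib

/-!
# Route `ExtremiserTransience`, LINE g5-α (seat ns-idea-5): Lebesgue scaling of the near-plateau set under the
# parabolic zoom — Step 4 bookkeeping of S1 (`stub_plateauScalesFixed`, item 27822 `PlateauSliceTransfer`)

`--supports stmt-NavierStokesRegularity-27822`.  The S1 plan (line card §S1-PLAN on 27822) zooms a slice `v = u(t)`
at centre `x₀` with amplitude `A` and length `ν/A`: `V(y) = A⁻¹ • v(x₀ + (ν/A)•y)`.  The near-plateau set of the
stability statement `LocalNearPlateauStability` — `{x ∈ B(x₀, ρ) : (1−δ)M ≤ |v x|}` — becomes the set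
`{y ∈ B(0, R) : (1−δ)(M/A) ≤ |V y|}` with `ρ = νR/A`, and its Lebesgue measure is multiplied by `(A/ν)³`
(`volume_zoom_nearPlateau`).  This is the identity that turns the LNPS volume fraction `c₀·radius³` into the fixed
`η = c₀R³` of S1's output once the zoom scale is the dissipation length (`R = r`).  Pure measure theory
(`Measure.addHaar_preimage_smul`, translation invariance); nothing about Navier–Stokes is proved here, and no
summit is proved by a line. [folklore]
-/

noncomputable section

open Set MeasureTheory

namespace Summit.NavierStokesRegularity.NavierStokesRegularity.Theorems.ExtremiserTransience

/-- The zoomed near-plateau set is the preimage of the original one under the affine zoom `y ↦ x₀ + (ν/A)•y`.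
[folklore] -/
theorem zoom_nearPlateau_eq_preimage (v : EuclideanSpace ℝ (Fin 3) → EuclideanSpace ℝ (Fin 3))
    (x₀ : EuclideanSpace ℝ (Fin 3)) {A ν : ℝ} (hA : 0 < A) (hν : 0 < ν) (R M δ : ℝ) :
    {y : EuclideanSpace ℝ (Fin 3) | y ∈ Metric.ball (0 : EuclideanSpace ℝ (Fin 3)) R ∧
        (1 - δ) * (M / A) ≤ ‖A⁻¹ • v (x₀ + (ν / A) • y)‖} =
      (fun y : EuclideanSpace ℝ (Fin 3) => (ν / A) • y) ⁻¹'
        ((fun z : EuclideanSpace ℝ (Fin 3) => x₀ + z) ⁻¹'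
          {x | x ∈ Metric.ball x₀ (ν / A * R) ∧ (1 - δ) * M ≤ ‖v x‖}) := by
  have hc : 0 < ν / A := div_pos hν hA
  ext y
  simp only [Set.mem_setOf_eq, Set.mem_preimage, Metric.mem_ball, dist_eq_norm, sub_zero,
    add_sub_cancel_left, norm_smul, Real.norm_eq_abs, abs_of_pos hc, abs_of_pos (inv_pos.2 hA)]
  constructor
  · rintro ⟨h1, h2⟩
    refine ⟨by exact mul_lt_mul_of_pos_left h1 hc, ?_⟩
    have h3 : (1 - δ) * M / A ≤ ‖v (x₀ + (ν / A) • y)‖ / A := by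
      rw [mul_div_assoc, div_eq_inv_mul (‖_‖)]
      exact h2
    exact (div_le_div_iff_of_pos_right hA).1 h3
  · rintro ⟨h1, h2⟩
    refine ⟨lt_of_mul_lt_mul_left h1 hc.le, ?_⟩
    have h3 : (1 - δ) * M / A ≤ ‖v (x₀ + (ν / A) • y)‖ / A := div_le_div_of_nonneg_right h2 hA.le
    rw [mul_div_assoc, div_eq_inv_mul (‖_‖)] at h3
    exact h3

/-- **Lebesgue scaling of the near-plateau set under the zoom** (S1 Step 4): with `V(y) = A⁻¹ • v(x₀ + (ν/A)•y)`,
`vol{y ∈ B(0,R) : (1−δ)(M/A) ≤ |V y|} = (A/ν)³ · vol{x ∈ B(x₀, νR/A) : (1−δ)M ≤ |v x|}`. [folklore] -/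
theorem volume_zoom_nearPlateau (v : EuclideanSpace ℝ (Fin 3) → EuclideanSpace ℝ (Fin 3))
    (x₀ : EuclideanSpace ℝ (Fin 3)) {A ν : ℝ} (hA : 0 < A) (hν : 0 < ν) (R M δ : ℝ) :
    volume {y : EuclideanSpace ℝ (Fin 3) | y ∈ Metric.ball (0 : EuclideanSpace ℝ (Fin 3)) R ∧
        (1 - δ) * (M / A) ≤ ‖A⁻¹ • v (x₀ + (ν / A) • y)‖} =
      ENNReal.ofReal ((A / ν) ^ 3) *
        volume {x : EuclideanSpace ℝ (Fin 3) | x ∈ Metric.ball x₀ (ν / A * R) ∧ (1 - δ) * M ≤ ‖v x‖} := by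
  have hc : 0 < ν / A := div_pos hν hA
  rw [zoom_nearPlateau_eq_preimage v x₀ hA hν R M δ, Measure.addHaar_preimage_smul volume hc.ne',
    measure_preimage_add, finrank_euclideanSpace, Fintype.card_fin]
  congr 2
  rw [abs_of_pos (inv_pos.2 (pow_pos hc 3)), ← inv_pow, inv_div]

/-- The same identity as the LOWER BOUND S1 consumes: an LNPS-type volume fraction `η₀ ≤ vol{x ∈ B(x₀, νR/A) :
(1−δ)M ≤ |v x|}` gives `(A/ν)³ η₀ ≤ vol{y ∈ B(0,R) : (1−δ)(M/A) ≤ |V y|}`. [folklore] -/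
theorem volume_zoom_nearPlateau_ge (v : EuclideanSpace ℝ (Fin 3) → EuclideanSpace ℝ (Fin 3))
    (x₀ : EuclideanSpace ℝ (Fin 3)) {A ν : ℝ} (hA : 0 < A) (hν : 0 < ν) (R M δ : ℝ) {η₀ : ℝ}
    (h : ENNReal.ofReal η₀ ≤
      volume {x : EuclideanSpace ℝ (Fin 3) | x ∈ Metric.ball x₀ (ν / A * R) ∧ (1 - δ) * M ≤ ‖v x‖}) :
    ENNReal.ofReal ((A / ν) ^ 3 * η₀) ≤
      volume {y : EuclideanSpace ℝ (Fin 3) | y ∈ Metric.ball (0 : EuclideanSpace ℝ (Fin 3)) R ∧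
        (1 - δ) * (M / A) ≤ ‖A⁻¹ • v (x₀ + (ν / A) • y)‖} := by
  rw [volume_zoom_nearPlateau v x₀ hA hν R M δ,
    ENNReal.ofReal_mul (pow_nonneg (div_pos hA hν).le 3)]
  gcongr

end Summit.NavierStokesRegularity.NavierStokesRegularity.Theorems.ExtremiserTransience

end
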